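import Literature.MathematicalPhysics.QuantumFieldTheory.Balaban1983to89.B9Ineq347GAAtLetters
import Literature.MathematicalPhysics.QuantumFieldTheory.Balaban1983to89.B9Ineq346GpFlatMultiLevelTorus
import Literature.MathematicalPhysics.QuantumFieldTheory.Balaban1983to89.B9Cor35ComparisonsEHAtLetters

/-!
# `Balaban1983to89.B9Ineq346GpAtLetters` — [B9] (3.46) AT U = 1 FOR G′(1), THE THREE MEMBERS `‖hG′λ‖, ‖h∇_UG′λ‖, ‖hG′∇*_Uλ‖` THAT FOLLOW
# FROM [4] (2.67) BY SCHUR'S TEST, AT NODE 00's OPERATOR LAYER OF LETTERS: the member-leaves n = 0, 1, 2 of the (3.46) leaf of row 11 (`hGp`)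
# are THEOREMS at `ops := Node00.opsYOfLetters N θ M⋆ 𝔏 𝔈`, for EVERY letter record `𝔏` — lit-balaban-p21's torus theorems READ through def-Y's reading

T. Bałaban, *Propagators for lattice gauge theories in a background field*, Commun. Math. Phys. **99** (1985) 389–434
[`Balaban1985BackgroundPropagators`, "B9"]; [4] = T. Bałaban, *Propagators and renormalization transformations for lattice
gauge theories. II*, Commun. Math. Phys. **96** (1984) 223–250 [`Balaban1984PropagatorsII`].

statement-level skeleton of published theorems with citation tags; proofs where landed; nothing here is a claim about the
Yang–Mills mass gap

THE PRINTED LOCI (verbatim).  (3.46), p. 398: *"Finally, we have the inequalities in L²-norms ‖hG′(U)λ‖, ‖h∇_UG′(U)λ‖, ‖hG′(U)∇\*_Uλ‖,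
‖h∇_UG′(U)∇\*_Uλ‖, ‖h∇_U∇_UG′(U)λ‖, ‖hG′(U)∇\*_U∇\*_Uλ‖ ≦ B₀[(Lʲη)², Lʲη, Lʲη, 1, 1, 1]|h|e^{−δ₀d(y,y′)}‖λ‖ for supp h ⊂ Δ̃(y), y ∈ Λ_j,
supp λ ⊂ Δ(y′); (3.46)"*; p. 398: *"the choice of powers Lʲη is conventional also. Using Lemma 2.1 in [4] we may replace the factor
(Lʲη)^α by (Lʲη)^β(L^{j′}η)^γ with β + γ = α"*; Cor. 3.5, p. 407: *"For operators with the external gauge field configuration U = 1, these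
theorems are proved in [4]"* — but [4] prints at U = 1 only the sup ∕ Hölder members (2.67) (cell GAP G-B9-03a).

THE POINT.  After `B9Ineq347GpAtLetters` (the (3.47) leaf) row 11 of the N06 knit at def-Y's instance is the FOUR leaves (3.46) ∕ (3.43)Δ̃ ∕ (3.44) ∕
(3.45) of G′(1) on site arguments.  The (3.46) leaf `AtOneL2On` is the conjunction of its six member-leaves `AtOneL2nOn … n` (my g0 file
`B9ResidualEntriesAtOne.atOneL2On_of_members`).  lit-balaban-p21 PROVED members n = 0, 1, 2 at U = 1 for `G′ = gmlT` on the genuine k-level torus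
from the sup members (2.67) by Schur's test (`B9Ineq346GpFlatMultiLevelTorus.ineq346_Gp∕dGp∕Gpd_flat_multiLevelTorus`: atomic form — `h` the
indicator of ONE block, `λ` in one block, squared, weights `L^{m(j+j′)}`).  At the Stage-3′(Y) carriers the site cut-offs and supports ARE one-block
(`KTIdx.geoT.cutIn ∕ suppIn`, read through `Node00.kGeoU`), so THIS FILE turns those three theorems into the member-leaves n = 0, 1, 2 at
`ops := opsYOfLetters …` for EVERY `𝔏` (flatness clause `Gp_one`): the weight `L^{mj′}` is moved to `L^{mj}` by p21's (2.60) transfer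
(`transfer_rpow`, squared form, before the square root), the `η^m` of def-Y's reading (`kernelFamilyS.l2`, `etaS = |c_f|⁻¹` in print's units)
makes `(Lʲη)^m`, and `‖·‖` of a lift is `≤` r03's flat `l2Of` (dag-n06-g's `l2OfY_liftY_le`).

* §1 (private `mul_iSup_le`, `sqrt_le_of_sq_bound`), `sum_sq_cut_le` (a cut-off supported in one block: `Σ_x(h(x)g(x))² ≤ |h|²·Σ_{x∈B(y)}g(x)²`),
  ★ `l2_member_bound` (ONE torus lemma for all three members: p21's squared block bound with weights `L^{mj}L^{mj′}` ⇒
  `η^m‖h·Tλ‖ ≤ √K·(Lʲη)^m·|h|·e^{−(δ∕8)d(y,y′)}·‖λ‖`, via (2.60) and the square root).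
* §2 ★ `ineq346_Gp_kIdx_members` — (3.46)₀,₁,₂ AT U = 1 FOR T8's `KTIdx.G` at every k-level index above a threshold, print's units, one-block
  cut-offs ∕ supports (p21's three theorems at `KIdx.aPrinted_windows` + `consts_260_261`'s size condition).
* §3 letter ∕ member level: `l2S0_one_le`, `l2S1_one_le`, `l2S2_one_le` (the reading's L² quantities at U = 1 on `f ⊗ E` vs `l2Of`), `Gp_l2_one_inl_inl`
  (`rfl`), ★ `Gp_l2_one_inl_inl_le0∕1∕2`.
* §4 ★★ `atOneL2nOn_Gp_letters_0 ∕ _1 ∕ _2` — THE THREE MEMBER-LEAVES HOLD at the layer of letters, every `𝔏 𝔈`; ★★ `residualGpAtOne_letters_of_leaves`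
  — ROW 11 at the layer ⇐ (3.46)₃,₄,₅ (`AtOneL2nOn … 3∕4∕5`) + (3.43)Δ̃ + (3.44) + (3.45): EXACTLY the entries [4] does not print at U = 1;
  record faces ★★ `atOneL2nOn_Gp_opsYOfLetters_0∕1∕2`, ★★ `hGp_opsYOfLetters_of_leaves`.

HONEST SCOPE.  Three MEMBER-leaves of one leaf of row 11 are discharged at the layer of letters; their analytic content (Schur's test on [4] (2.67),
(2.60)) is lit-balaban-p21's, only READ here.  The residual of row 11 after this file — (3.46) members ∇G′∇\*, ∇∇G′, G′∇\*∇\*, (3.43) with Δ̃-cut-offs,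
(3.44), (3.45) for G′(1) — has NO sup majorant in [4] (G-B9-03a ∕ G-B9-20) and stays displayed.  The letters are NOT constructed (def-Y's successor
`lettersYOfRecord`); nothing of [B9] is asserted; count-neutral; N06 NOT discharged; one finite lattice programme — nothing continuum, nothing about
the mass gap.  Cell `pub-ymgap` (HUMAN RULING D-0062), Track A node N06 [B9], N06-ASSIGNMENT v1 row 11 (bundle F3) at def-Y's instance, seat
`pub-ymgap-dag-n06-h` (g2), 2026-08-27.
-/

noncomputable section

namespace Literature.MathematicalPhysics.QuantumFieldTheory.Balaban1983to89.B9Ineq346GpAtLetters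

open B4Reflection242 (boxDom)
open B6MultiLevelBoxOperator (N0 aPrinted)
open B6MultiLevelTorusOperator (TDomains)
open B6Prop22DerivMultiLevelTorus (dT)
open B6Geom246MultiLevelBox (bset blkOf)
open B6Geom246MultiLevelTorus (geomT)
open B6Ineq2142KLevelV1 (β beta_level)
open B6KLevelCensusIndexV1 (KIdx kGeo)
open B6Prop22KLevelTorusCensus (KTIdx)
open B6Prop26Census2136KLevelV1 (l2Of)
open B9Thm314GpFlatMultiLevelTorus (consts_260_261)
open B9Ineq347GpFlatMultiLevelTorus (transfer_rpow)
open B9Ineq346GpFlatMultiLevelTorus (ineq346_Gp_flat_multiLevelTorus ineq346_dGp_flat_multiLevelTorus ineq346_Gpd_flat_multiLevelTorus)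
open B9Cor35ComparisonsGpCAtLetters (cdS_one_liftY cdsS_one_liftY)
open B9Cor35ComparisonsGAAtLetters (l2OfY_liftY_le)
open B9Cor35ComparisonsEHAtLetters (Gp_l2_inl_inr)
open B9Ineq347GpAtLetters (etaS_toKIdx atOneGlobOn_Gp_letters)
open B9PinCarriersNonVacuity (l2Of_nonneg)
open B9FromB6 (ResidualGpAtOne pref6_nonneg)
open B9ResidualEntriesAtOne (AtOneL2On AtOneL2nOn AtOneH1On AtOneE4On AtOneH2On atOneL2On_of_members)
open B9ResidualEntriesAtOneAtLetters (residualGpAtOne_letters_of_blocksOn)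
open B9PinMembersKLevelV1 (MemberY geo9Y bg9Y)
open B7Prop2SpecialUnitary (specialUnitaryUnits)
open Node00
open scoped Matrix

variable {d ℓ : ℕ} {hd : 1 ≤ d + 1} {hL : Odd (ℓ + 1) ∧ 1 < ℓ + 1} {b₀ b₁ : ℝ} {Mstar : ℕ}
variable {𝔸 : Type} [NormedRing 𝔸] [NormedAlgebra ℂ 𝔸] [CompleteSpace 𝔸]

/-! ## §1 Scalar bookkeeping and ONE torus lemma for the three members -/

section Scalar

/-- a real supremum times a nonnegative scalar is bounded when each member is. [folklore] -/
private theorem mul_iSup_le {ι : Type} {u : ι → ℝ} {η R : ℝ} (hη : 0 ≤ η) (hR : 0 ≤ R) (h : ∀ k, η * u k ≤ R) :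
    η * (⨆ k, u k) ≤ R := by
  rcases hη.eq_or_lt with hη0 | hηpos
  · rw [← hη0, zero_mul]; exact hR
  · have hk : ∀ k, u k ≤ R / η := fun k => (le_div_iff₀ hηpos).2 (by rw [mul_comm]; exact h k)
    calc η * (⨆ k, u k) ≤ η * (R / η) := mul_le_mul_of_nonneg_left (Real.iSup_le hk (div_nonneg hR hη)) hη
      _ = R := mul_div_cancel₀ R hηpos.ne'

/-- the square-root step of Schur's bound: `A ≤ S²·(K·P²·E²·Q)` gives `√A ≤ S·(√K·P·E·√Q)` (all factors `≥ 0`). [folklore] -/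
private theorem sqrt_le_of_sq_bound {A S K P E Q : ℝ} (hS : 0 ≤ S) (hK : 0 ≤ K) (hP : 0 ≤ P) (hE : 0 ≤ E) (hQ : 0 ≤ Q)
    (h : A ≤ S ^ 2 * (K * P ^ 2 * E ^ 2 * Q)) : Real.sqrt A ≤ S * (Real.sqrt K * P * E * Real.sqrt Q) := by
  refine (Real.sqrt_le_left (by positivity)).2 (h.trans_eq ?_)
  simp only [mul_pow, Real.sq_sqrt hK, Real.sq_sqrt hQ]

/-- **a cut-off supported in ONE block**: `Σ_x (h(x)g(x))² ≤ (sup|h|)²·Σ_{x∈B(y)} g(x)²`.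
[cite: Balaban1985BackgroundPropagators, (3.46) p.398 («supp h ⊂ Δ̃(y)», one-block case), bookkeeping] -/
theorem sum_sq_cut_le {Mh k R : ℕ} {P : Fin (d + 1) → ℕ} (D : TDomains d ℓ Mh k P R) (s : ↥(bset D.toDomains))
    (hh g : ↥(boxDom (N0 ℓ Mh k P)) → ℝ) (hhh : ∀ x, hh x ≠ 0 → blkOf D.toDomains x = s) :
    ∑ x, (hh x * g x) ^ 2 ≤ (⨆ x, |hh x|) ^ 2 * ∑ x ∈ Finset.univ.filter (fun x => blkOf D.toDomains x = s), g x ^ 2 := by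
  classical
  have hS : ∀ x, |hh x| ≤ ⨆ x, |hh x| := fun x => le_ciSup (Set.finite_range fun x => |hh x|).bddAbove x
  rw [Finset.sum_filter, Finset.mul_sum]
  refine Finset.sum_le_sum fun x _ => ?_
  split_ifs with hx
  · rw [mul_pow, ← sq_abs (hh x)]
    exact mul_le_mul_of_nonneg_right (pow_le_pow_left₀ (abs_nonneg _) (hS x) 2) (sq_nonneg _)
  · have h0 : hh x = 0 := by
      by_contra h
      exact hx (hhh x h)
    simp [h0]

/-- ★ **ONE TORUS LEMMA FOR THE THREE MEMBERS** — from p21's squared block bound with weights `L^{mj(y)}L^{mj(y′)}e^{−δd}` (`m = 2` for `G′`, `m = 1`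
for `∇_μG′`, `G′∇_μᵀ`), the (2.60) transfer `e^{−¾δd}L^{mj′} ≤ L^m L^{mj}` (size condition `L² ≤ e^{¼δ(R·L·M_h − 1)}`), the one-block cut-off and the square
root: `η^m‖h·Tλ‖ ≤ √K·(Lʲη)^m·|h|·e^{−(δ∕8)d(y,y′)}·‖λ‖` whenever `C·L^m ≤ K` (`η ≥ 0` arbitrary).
[cite: Balaban1985BackgroundPropagators, (3.46) p.398 + p.398 (powers conventional, Lemma 2.1); Balaban1984PropagatorsII, (2.60) p.234] -/
theorem l2_member_bound {Mh k R : ℕ} {P : Fin (d + 1) → ℕ} (D : TDomains d ℓ Mh k P R) (hMh : 1 ≤ Mh) (hP : ∀ μ, 1 ≤ P μ)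
    (hRM : 1 ≤ R * ((ℓ + 1) * Mh)) {T : Matrix ↥(boxDom (N0 ℓ Mh k P)) ↥(boxDom (N0 ℓ Mh k P)) ℝ} {C δ K : ℝ} {m : ℕ}
    (hC : 0 ≤ C) (hδ : 0 ≤ δ) (hm : m ≤ 2) (hK : C * ((ℓ : ℝ) + 1) ^ m ≤ K)
    (hthr : ((ℓ : ℝ) + 1) ^ 2 ≤ Real.exp (1 / 4 * δ * ((R : ℝ) * (((ℓ : ℝ) + 1) * Mh) - 1)))
    (s s' : ↥(bset D.toDomains)) (hh f : ↥(boxDom (N0 ℓ Mh k P)) → ℝ) (hhh : ∀ x, hh x ≠ 0 → blkOf D.toDomains x = s)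
    (h346 : ∑ x ∈ Finset.univ.filter (fun x => blkOf D.toDomains x = s), ((T *ᵥ f) x) ^ 2
      ≤ C * ((ℓ : ℝ) + 1) ^ (m * s.1.1) * ((ℓ : ℝ) + 1) ^ (m * s'.1.1) * Real.exp (-(δ * (geomT D).dist s s')) * ∑ z, f z ^ 2)
    {η : ℝ} (hη : 0 ≤ η) :
    η ^ m * l2Of hh (T *ᵥ f) ≤ Real.sqrt K * (((ℓ : ℝ) + 1) ^ s.1.1 * η) ^ m * (⨆ x, |hh x|)
      * Real.exp (-(δ / 8 * (geomT D).dist s s')) * Real.sqrt (∑ z, f z ^ 2) := by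
  have hL0 : (0 : ℝ) < (ℓ : ℝ) + 1 := by positivity
  have hL1 : (1 : ℝ) ≤ (ℓ : ℝ) + 1 := by linarith [(Nat.cast_nonneg ℓ : (0 : ℝ) ≤ ℓ)]
  have hdd : 0 ≤ (geomT D).dist s s' := by exact Nat.cast_nonneg _
  have hS : 0 ≤ ⨆ x, |hh x| := Real.iSup_nonneg fun _ => abs_nonneg _
  have hQ : 0 ≤ ∑ z, f z ^ 2 := Finset.sum_nonneg fun _ _ => sq_nonneg _
  have hX : 0 ≤ (R : ℝ) * (((ℓ : ℝ) + 1) * Mh) - 1 := by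
    have : (1 : ℝ) ≤ (R : ℝ) * (((ℓ : ℝ) + 1) * Mh) := by exact_mod_cast hRM
    linarith
  -- the size condition of the (2.60) transfer at exponent `m ≤ 2`
  have hthr' : ((ℓ : ℝ) + 1) ^ |(m : ℝ)| ≤ Real.exp (3 / 4 * δ * ((R : ℝ) * (((ℓ : ℝ) + 1) * Mh) - 1)) := by
    rw [abs_of_nonneg (Nat.cast_nonneg m), Real.rpow_natCast]
    calc ((ℓ : ℝ) + 1) ^ m ≤ ((ℓ : ℝ) + 1) ^ 2 := pow_le_pow_right₀ hL1 hm
      _ ≤ _ := hthr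
      _ ≤ _ := Real.exp_le_exp.2 (by nlinarith [mul_nonneg hδ hX])
  have htr := transfer_rpow D hMh hP hRM hδ (m : ℝ) hthr' s s'
  rw [abs_of_nonneg (Nat.cast_nonneg m), Real.rpow_natCast, ← Nat.cast_mul, ← Nat.cast_mul, Real.rpow_natCast, Real.rpow_natCast] at htr
  -- the squared bound with the weight moved to the block of `h`
  have hsplit : Real.exp (-(δ * (geomT D).dist s s'))
      = Real.exp (-(δ / 4 * (geomT D).dist s s')) * Real.exp (-(3 / 4 * δ * (geomT D).dist s s')) := by
    rw [← Real.exp_add]; congr 1; ring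
  have h1 : ∑ x ∈ Finset.univ.filter (fun x => blkOf D.toDomains x = s), ((T *ᵥ f) x) ^ 2
      ≤ C * ((ℓ : ℝ) + 1) ^ m * (((ℓ : ℝ) + 1) ^ (m * s.1.1)) ^ 2 * Real.exp (-(δ / 4 * (geomT D).dist s s')) * ∑ z, f z ^ 2 := by
    calc _ ≤ _ := h346
      _ = C * ((ℓ : ℝ) + 1) ^ (m * s.1.1) * (∑ z, f z ^ 2) * Real.exp (-(δ / 4 * (geomT D).dist s s'))
            * (Real.exp (-(3 / 4 * δ * (geomT D).dist s s')) * ((ℓ : ℝ) + 1) ^ (m * s'.1.1)) := by rw [hsplit]; ring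
      _ ≤ C * ((ℓ : ℝ) + 1) ^ (m * s.1.1) * (∑ z, f z ^ 2) * Real.exp (-(δ / 4 * (geomT D).dist s s'))
            * (((ℓ : ℝ) + 1) ^ m * ((ℓ : ℝ) + 1) ^ (m * s.1.1)) := mul_le_mul_of_nonneg_left htr (by positivity)
      _ = _ := by ring
  -- the cut-off, then the square root
  have h2 : ∑ x, (hh x * (T *ᵥ f) x) ^ 2 ≤ (⨆ x, |hh x|) ^ 2 *
      (C * ((ℓ : ℝ) + 1) ^ m * (((ℓ : ℝ) + 1) ^ (m * s.1.1)) ^ 2 * Real.exp (-(δ / 8 * (geomT D).dist s s')) ^ 2 * ∑ z, f z ^ 2) := by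
    have hexp : Real.exp (-(δ / 8 * (geomT D).dist s s')) ^ 2 = Real.exp (-(δ / 4 * (geomT D).dist s s')) := by
      rw [← Real.exp_nat_mul]; congr 1; ring
    rw [hexp]
    exact (sum_sq_cut_le D s hh (T *ᵥ f) hhh).trans (mul_le_mul_of_nonneg_left h1 (sq_nonneg _))
  have h3 : l2Of hh (T *ᵥ f) ≤ (⨆ x, |hh x|) * (Real.sqrt (C * ((ℓ : ℝ) + 1) ^ m) * ((ℓ : ℝ) + 1) ^ (m * s.1.1)
      * Real.exp (-(δ / 8 * (geomT D).dist s s')) * Real.sqrt (∑ z, f z ^ 2)) :=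
    sqrt_le_of_sq_bound hS (by positivity) (by positivity) (Real.exp_pos _).le hQ h2
  have hsqrt : Real.sqrt (C * ((ℓ : ℝ) + 1) ^ m) ≤ Real.sqrt K := Real.sqrt_le_sqrt hK
  -- assembly: `η^m·L^{mj} = (Lʲη)^m`
  have hpow : η ^ m * ((ℓ : ℝ) + 1) ^ (m * s.1.1) = (((ℓ : ℝ) + 1) ^ s.1.1 * η) ^ m := by
    rw [mul_pow, ← pow_mul, mul_comm (s.1.1) m]; ring
  have hW : 0 ≤ (⨆ x, |hh x|) * ((ℓ : ℝ) + 1) ^ (m * s.1.1) * Real.exp (-(δ / 8 * (geomT D).dist s s')) * Real.sqrt (∑ z, f z ^ 2) := by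
    positivity
  calc η ^ m * l2Of hh (T *ᵥ f)
      ≤ η ^ m * ((⨆ x, |hh x|) * (Real.sqrt (C * ((ℓ : ℝ) + 1) ^ m) * ((ℓ : ℝ) + 1) ^ (m * s.1.1)
          * Real.exp (-(δ / 8 * (geomT D).dist s s')) * Real.sqrt (∑ z, f z ^ 2))) := mul_le_mul_of_nonneg_left h3 (pow_nonneg hη m)
    _ = Real.sqrt (C * ((ℓ : ℝ) + 1) ^ m) * (η ^ m * ((⨆ x, |hh x|) * ((ℓ : ℝ) + 1) ^ (m * s.1.1)
          * Real.exp (-(δ / 8 * (geomT D).dist s s')) * Real.sqrt (∑ z, f z ^ 2))) := by ring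
    _ ≤ Real.sqrt K * (η ^ m * ((⨆ x, |hh x|) * ((ℓ : ℝ) + 1) ^ (m * s.1.1)
          * Real.exp (-(δ / 8 * (geomT D).dist s s')) * Real.sqrt (∑ z, f z ^ 2))) :=
        mul_le_mul_of_nonneg_right hsqrt (mul_nonneg (pow_nonneg hη m) hW)
    _ = Real.sqrt K * (η ^ m * ((ℓ : ℝ) + 1) ^ (m * s.1.1)) * (⨆ x, |hh x|)
          * Real.exp (-(δ / 8 * (geomT D).dist s s')) * Real.sqrt (∑ z, f z ^ 2) := by ring
    _ = _ := by rw [hpow]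

end Scalar

/-! ## §2 (3.46)₀,₁,₂ at U = 1 for NODE 00's `G′ = KTIdx.G` at every k-level index, print's units, one-block cut-offs -/

section KLevel

/-- ★ **(3.46), MEMBERS `‖hG′λ‖, ‖h∇_μG′λ‖, ‖hG′∇_μᵀλ‖`, AT `U = 1` FOR `G′ = Δ′_a⁻¹` (T8's `KTIdx.G`) AT EVERY k-LEVEL V1 INDEX ABOVE A THRESHOLD —
PRINT'S UNITS, ONE-BLOCK CUT-OFF `h` AND SUPPORT.**  There are `M₁, C, δ₀ > 0` such that for every index with `M = L·M_h ≥ M₁`, all blocks `y, y′`,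
every cut-off `h` supported in `B(y)` and every `λ` supported in `B(y′)` (`η = |c_f|⁻¹`, `j = j(y)`):
`η²‖hG′λ‖ ≤ C(Lʲη)²|h|e^{−δ₀d(y,y′)}‖λ‖`, `η‖h∂_μG′λ‖, η‖hG′∂_μᵀλ‖ ≤ C(Lʲη)|h|e^{−δ₀d(y,y′)}‖λ‖` (flat `L²` norms `l2Of`, `‖λ‖ = (Σλ²)^{1/2}`,
`|h| = sup|h|`).  lit-balaban-p21's `ineq346_Gp∕dGp∕Gpd_flat_multiLevelTorus` at the printed weights + §1.
[cite: Balaban1985BackgroundPropagators, Thm 3.1 (3.46) p.398 + Cor. 3.5 p.407; Balaban1984PropagatorsII, Prop. 2.2 (2.67), Lemma 2.1 (2.60) p.234] -/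
theorem ineq346_Gp_kIdx_members : ∃ M₁ C δ₀ : ℝ, 0 < M₁ ∧ 0 < C ∧ 0 < δ₀ ∧
    ∀ i : KIdx d ℓ hd hL b₀ b₁, M₁ ≤ (kGeo i).M → ∀ (s s' : ↥(bset i.D.toDomains)) (hh f : SiteY i → ℝ),
      (∀ x, hh x ≠ 0 → blkOf i.D.toDomains x = s) → (∀ x, f x ≠ 0 → blkOf i.D.toDomains x = s') →
      |i.cf|⁻¹ ^ 2 * l2Of hh ((toKT i).G *ᵥ f) ≤ C * (((ℓ : ℝ) + 1) ^ s.1.1 * |i.cf|⁻¹) ^ 2 * (⨆ x, |hh x|)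
          * Real.exp (-(δ₀ * (geomT i.D).dist s s')) * Real.sqrt (∑ z, f z ^ 2) ∧
      (∀ μ : Fin (d + 1), |i.cf|⁻¹ * l2Of hh ((dT (toKT i).NB μ * (toKT i).G) *ᵥ f) ≤
          C * (((ℓ : ℝ) + 1) ^ s.1.1 * |i.cf|⁻¹) * (⨆ x, |hh x|)
            * Real.exp (-(δ₀ * (geomT i.D).dist s s')) * Real.sqrt (∑ z, f z ^ 2)) ∧
      (∀ μ : Fin (d + 1), |i.cf|⁻¹ * l2Of hh (((toKT i).G * (dT (toKT i).NB μ)ᵀ) *ᵥ f) ≤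
          C * (((ℓ : ℝ) + 1) ^ s.1.1 * |i.cf|⁻¹) * (⨆ x, |hh x|)
            * Real.exp (-(δ₀ * (geomT i.D).dist s s')) * Real.sqrt (∑ z, f z ^ 2)) := by
  by_cases hℓ : 1 ≤ ℓ
  swap
  · exact ⟨1, 1, 1, one_pos, one_pos, one_pos, fun i => absurd (le_trans (by norm_num) i.hℓ) hℓ⟩
  have hL0 : (0 : ℝ) < (ℓ : ℝ) + 1 := by positivity
  have hL1 : (1 : ℝ) ≤ (ℓ : ℝ) + 1 := by linarith [(Nat.cast_nonneg ℓ : (0 : ℝ) ≤ ℓ)]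
  have hL2 : (1 : ℝ) < ((ℓ : ℝ) + 1) ^ 2 := by
    have h1 : (1 : ℝ) ≤ ℓ := by exact_mod_cast hℓ
    nlinarith
  have hamin : 0 < 1 - ((((ℓ : ℝ) + 1)) ^ 2)⁻¹ := by
    rw [sub_pos]
    exact inv_lt_one_of_one_lt₀ hL2
  obtain ⟨hwin, hrec⟩ := B6Prop22KLevelCensus.KIdx.aPrinted_windows hℓ
  obtain ⟨δa, Ca, Ma, Na, hδa, hCa, hMa, -, Ha⟩ :=
    ineq346_Gp_flat_multiLevelTorus d ℓ hℓ (1 - ((((ℓ : ℝ) + 1)) ^ 2)⁻¹) 1 1 1 hamin one_pos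
  obtain ⟨δb, Cb, Mb, Nb, hδb, hCb, hMb, -, Hb⟩ :=
    ineq346_dGp_flat_multiLevelTorus d ℓ hℓ (1 - ((((ℓ : ℝ) + 1)) ^ 2)⁻¹) 1 1 1 hamin one_pos
  obtain ⟨δc, Cc, Mc, Nc', hδc, hCc, hMc, -, Hc⟩ :=
    ineq346_Gpd_flat_multiLevelTorus d ℓ hℓ (1 - ((((ℓ : ℝ) + 1)) ^ 2)⁻¹) 1 1 1 hamin one_pos
  -- one common rate and the size-condition threshold at it
  have hδ : 0 < min δa (min δb δc) := lt_min hδa (lt_min hδb hδc)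
  obtain ⟨Nq, cq, -, -, hconq⟩ := consts_260_261 d ℓ hδ
  refine ⟨max (max Ma (max Mb Mc)) (((max (max Na (max Nb Nc')) Nq : ℕ) : ℝ) + 1),
    Real.sqrt (max Ca (max Cb Cc) * ((ℓ : ℝ) + 1) ^ 2), min δa (min δb δc) / 8,
    lt_max_of_lt_left (lt_max_of_lt_left hMa), Real.sqrt_pos.2 (by positivity), by positivity, ?_⟩
  intro i hM s s' hh f hhh hf
  have hLcast : (((ℓ + 1 : ℕ) : ℝ)) = (ℓ : ℝ) + 1 := by push_cast; ring
  have hM' : max (max Ma (max Mb Mc)) (((max (max Na (max Nb Nc')) Nq : ℕ) : ℝ) + 1) ≤ ((ℓ : ℝ) + 1) * i.Mh := by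
    have hMdef : (kGeo i).M = (((ℓ + 1 : ℕ) : ℝ)) * (i.Mh : ℝ) := rfl
    rw [hMdef, hLcast] at hM
    exact hM
  have hMh3 : 3 ≤ i.Mh := le_trans (by norm_num) i.hM8
  have hMh1 : 1 ≤ i.Mh := le_trans (by norm_num) i.hM8
  have hMa' : Ma ≤ ((ℓ : ℝ) + 1) * i.Mh := ((le_max_left _ _).trans (le_max_left _ _)).trans hM'
  have hMb' : Mb ≤ ((ℓ : ℝ) + 1) * i.Mh := (((le_max_left _ _).trans (le_max_right _ _)).trans (le_max_left _ _)).trans hM'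
  have hMc' : Mc ≤ ((ℓ : ℝ) + 1) * i.Mh := (((le_max_right _ _).trans (le_max_right _ _)).trans (le_max_left _ _)).trans hM'
  have hR1 : 1 ≤ i.R := le_trans (by omega) (toKT i).hR
  have hRN : ∀ N : ℕ, N ≤ max (max Na (max Nb Nc')) Nq → N + 1 ≤ i.R * ((ℓ + 1) * i.Mh) := by
    intro N hN
    have h1 : (((max (max Na (max Nb Nc')) Nq : ℕ) : ℝ) + 1) ≤ ((ℓ : ℝ) + 1) * i.Mh := (le_max_right _ _).trans hM'
    have h2 : max (max Na (max Nb Nc')) Nq + 1 ≤ (ℓ + 1) * i.Mh := by exact_mod_cast h1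
    calc N + 1 ≤ 1 * ((ℓ + 1) * i.Mh) := by rw [one_mul]; omega
      _ ≤ i.R * ((ℓ + 1) * i.Mh) := Nat.mul_le_mul_right _ hR1
  have hRM1 : 1 ≤ i.R * ((ℓ + 1) * i.Mh) := le_trans (by omega) (hRN 0 (Nat.zero_le _))
  have hRNa : Na + 1 ≤ i.R * ((ℓ + 1) * i.Mh) := hRN Na ((le_max_left _ _).trans (le_max_left _ _))
  have hRNb : Nb + 1 ≤ i.R * ((ℓ + 1) * i.Mh) := hRN Nb (((le_max_left _ _).trans (le_max_right _ _)).trans (le_max_left _ _))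
  have hRNc : Nc' + 1 ≤ i.R * ((ℓ + 1) * i.Mh) := hRN Nc' (((le_max_right _ _).trans (le_max_right _ _)).trans (le_max_left _ _))
  obtain ⟨hthr, -⟩ := hconq i.k i.Mh i.R i.P' hMh1 (toKT i).hP (hRN Nq (le_max_right _ _))
  have hη : 0 ≤ |i.cf|⁻¹ := inv_nonneg.2 (abs_nonneg _)
  have hf0 : ∀ z, blkOf i.D.toDomains z ≠ s' → f z = 0 := fun z hz => by
    by_contra h
    exact hz (hf z h)
  -- weakening a package's decay to the common rate
  have hweak : ∀ {δ' : ℝ} {W : ℝ}, min δa (min δb δc) ≤ δ' → 0 ≤ W →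
      W * Real.exp (-(δ' * (geomT i.D).dist s s')) ≤ W * Real.exp (-(min δa (min δb δc) * (geomT i.D).dist s s')) := by
    intro δ' W hδ' hW
    refine mul_le_mul_of_nonneg_left (Real.exp_le_exp.2 ?_) hW
    have hdd : 0 ≤ (geomT i.D).dist s s' := by exact Nat.cast_nonneg _
    nlinarith
  have hKa : Ca * ((ℓ : ℝ) + 1) ^ 2 ≤ max Ca (max Cb Cc) * ((ℓ : ℝ) + 1) ^ 2 :=
    mul_le_mul_of_nonneg_right (le_max_left _ _) (by positivity)
  have hKb : Cb * ((ℓ : ℝ) + 1) ^ 1 ≤ max Ca (max Cb Cc) * ((ℓ : ℝ) + 1) ^ 2 :=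
    mul_le_mul ((le_max_left _ _).trans (le_max_right _ _)) (pow_le_pow_right₀ hL1 (by norm_num)) (by positivity)
      (hCa.le.trans (le_max_left _ _))
  have hKc : Cc * ((ℓ : ℝ) + 1) ^ 1 ≤ max Ca (max Cb Cc) * ((ℓ : ℝ) + 1) ^ 2 :=
    mul_le_mul ((le_max_right _ _).trans (le_max_right _ _)) (pow_le_pow_right₀ hL1 (by norm_num)) (by positivity)
      (hCa.le.trans (le_max_left _ _))
  refine ⟨?_, fun μ => ?_, fun μ => ?_⟩
  · -- member 0: `G′`, weight exponent m = 2
    have h := Ha i.k i.Mh i.R hMh3 hMa' (toKT i).hR hRNa i.P' (toKT i).hP (toKT i).hP4 i.D (aPrinted ℓ 1) (fun _ => 1) hwin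
      (fun j _ => ⟨le_rfl, le_rfl⟩) hrec s s' f hf0
    have h' : ∑ x ∈ Finset.univ.filter (fun x => blkOf i.D.toDomains x = s), (((toKT i).G *ᵥ f) x) ^ 2
        ≤ Ca * ((ℓ : ℝ) + 1) ^ (2 * s.1.1) * ((ℓ : ℝ) + 1) ^ (2 * s'.1.1)
          * Real.exp (-(min δa (min δb δc) * (geomT i.D).dist s s')) * ∑ z, f z ^ 2 := by
      refine h.trans ?_
      have := hweak (min_le_left δa (min δb δc))
        (show 0 ≤ Ca * ((ℓ : ℝ) + 1) ^ (2 * s.1.1) * ((ℓ : ℝ) + 1) ^ (2 * s'.1.1) by positivity)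
      exact mul_le_mul_of_nonneg_right this (Finset.sum_nonneg fun z _ => sq_nonneg (f z))
    exact l2_member_bound i.D hMh1 (toKT i).hP hRM1 hCa.le hδ.le le_rfl hKa hthr s s' hh f hhh h' hη
  · -- member 1: `∂_μG′`, m = 1
    have h := Hb i.k i.Mh i.R hMh3 hMb' (toKT i).hR hRNb i.P' (toKT i).hP (toKT i).hP4 i.D (aPrinted ℓ 1) (fun _ => 1) hwin
      (fun j _ => ⟨le_rfl, le_rfl⟩) hrec μ s s' f hf0
    have h' : ∑ x ∈ Finset.univ.filter (fun x => blkOf i.D.toDomains x = s), (((dT (toKT i).NB μ * (toKT i).G) *ᵥ f) x) ^ 2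
        ≤ Cb * ((ℓ : ℝ) + 1) ^ (1 * s.1.1) * ((ℓ : ℝ) + 1) ^ (1 * s'.1.1)
          * Real.exp (-(min δa (min δb δc) * (geomT i.D).dist s s')) * ∑ z, f z ^ 2 := by
      rw [one_mul, one_mul]
      refine h.trans ?_
      have := hweak ((min_le_right δa (min δb δc)).trans (min_le_left _ _))
        (show 0 ≤ Cb * ((ℓ : ℝ) + 1) ^ s.1.1 * ((ℓ : ℝ) + 1) ^ s'.1.1 by positivity)
      exact mul_le_mul_of_nonneg_right this (Finset.sum_nonneg fun z _ => sq_nonneg (f z))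
    have hb := l2_member_bound i.D hMh1 (toKT i).hP hRM1 hCb.le hδ.le (by norm_num) hKb hthr s s' hh f hhh h' hη
    rw [pow_one, pow_one] at hb
    exact hb
  · -- member 2: `G′∂_μᵀ`, m = 1
    have h := Hc i.k i.Mh i.R hMh3 hMc' (toKT i).hR hRNc i.P' (toKT i).hP (toKT i).hP4 i.D (aPrinted ℓ 1) (fun _ => 1) hwin
      (fun j _ => ⟨le_rfl, le_rfl⟩) hrec μ s s' f hf0
    have h' : ∑ x ∈ Finset.univ.filter (fun x => blkOf i.D.toDomains x = s), ((((toKT i).G * (dT (toKT i).NB μ)ᵀ) *ᵥ f) x) ^ 2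
        ≤ Cc * ((ℓ : ℝ) + 1) ^ (1 * s.1.1) * ((ℓ : ℝ) + 1) ^ (1 * s'.1.1)
          * Real.exp (-(min δa (min δb δc) * (geomT i.D).dist s s')) * ∑ z, f z ^ 2 := by
      rw [one_mul, one_mul]
      refine h.trans ?_
      have := hweak ((min_le_right δa (min δb δc)).trans (min_le_right _ _))
        (show 0 ≤ Cc * ((ℓ : ℝ) + 1) ^ s.1.1 * ((ℓ : ℝ) + 1) ^ s'.1.1 by positivity)
      exact mul_le_mul_of_nonneg_right this (Finset.sum_nonneg fun z _ => sq_nonneg (f z))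
    have hc := l2_member_bound i.D hMh1 (toKT i).hP hRM1 hCc.le hδ.le (by norm_num) hKc hthr s s' hh f hhh h' hη
    rw [pow_one, pow_one] at hc
    exact hc

end KLevel

/-! ## §3 At a site-sector letter and at a member: the reading's (3.46)₀,₁,₂ at `U = 1` -/

section Letter

variable (i : KIdx d ℓ hd hL b₀ b₁) (O : SiteOpY 𝔸 i)
  (hO : ∀ (f : SiteY i → ℝ) (E : 𝔸), O (fun _ _ => 1) (liftY f E) = liftY ((toKT i).G *ᵥ f) E)
include hO

/-- `‖h·G′(1)(f ⊗ E)‖ ≤ ‖h·G′f‖` (flat `L²`, `‖E‖ ≤ 1`). [cite: Balaban1985BackgroundPropagators, (3.46) p.398 + Cor. 3.5 p.407] -/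
theorem l2S0_one_le (hh f : SiteY i → ℝ) (E : BallY 𝔸) :
    l2OfY hh (O (fun _ _ => 1) (liftY f (E : 𝔸))) ≤ l2Of hh ((toKT i).G *ᵥ f) := by
  rw [hO]; exact l2OfY_liftY_le hh _ E

/-- `‖h·∇_{1,μ}G′(1)(f ⊗ E)‖ ≤ ‖h·∂_μG′f‖`. [cite: Balaban1985BackgroundPropagators, (3.46) p.398 + (3.3) p.390 + Cor. 3.5 p.407] -/
theorem l2S1_one_le (hh f : SiteY i → ℝ) (E : BallY 𝔸) (μ : Fin (d + 1)) :
    l2OfY hh (cdS i (fun _ _ => 1) μ (O (fun _ _ => 1) (liftY f (E : 𝔸)))) ≤ l2Of hh ((dT (toKT i).NB μ * (toKT i).G) *ᵥ f) := by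
  rw [hO, cdS_one_liftY, Matrix.mulVec_mulVec]; exact l2OfY_liftY_le hh _ E

/-- `‖h·G′(1)∇*_{1,μ}(f ⊗ E)‖ ≤ ‖h·G′∂_μᵀf‖`. [cite: Balaban1985BackgroundPropagators, (3.46) p.398 + (3.8) p.392 + Cor. 3.5 p.407] -/
theorem l2S2_one_le (hh f : SiteY i → ℝ) (E : BallY 𝔸) (μ : Fin (d + 1)) :
    l2OfY hh (O (fun _ _ => 1) (cdsS i (fun _ _ => 1) μ (liftY f (E : 𝔸)))) ≤ l2Of hh (((toKT i).G * (dT (toKT i).NB μ)ᵀ) *ᵥ f) := by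
  rw [cdsS_one_liftY, hO, Matrix.mulVec_mulVec]; exact l2OfY_liftY_le hh _ E

end Letter

section Member

variable {G : Subgroup 𝔸ˣ} (x : MemberY d ℓ hd hL b₀ b₁ Mstar) (𝔏 : CovLettersY 𝔸 x) (𝔈 : ExpLettersY 𝔸 G x)

/-- the (3.46) slots of def-Y's layer at `U = 1` on a site argument with a site cut-off, unfolded (`kernelFamilyS.l2` on `(.inl f, .inl h)`).
[cite: Balaban1985BackgroundPropagators, (3.46) p.398 (the reading; bookkeeping)] -/
theorem Gp_l2_one_inl_inl (n : Fin 6) (f hh : SiteY x.toKIdx → ℝ) :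
    (operatorLayerYOfLetters 𝔸 G x 𝔏 𝔈).Gp.l2 n (bg9Y 𝔸 G x).one (Sum.inl f) (Sum.inl hh) =
      etaS x.toKIdx ^ ((![2, 1, 1, 0, 0, 0] : Fin 6 → ℕ) n) * ⨆ E : BallY 𝔸,
        ((![l2OfY hh (𝔏.Gp (fun _ _ => 1) (liftY f (E : 𝔸))),
            ⨆ μ : Fin (d + 1), l2OfY hh (cdS x.toKIdx (fun _ _ => 1) μ (𝔏.Gp (fun _ _ => 1) (liftY f (E : 𝔸)))),
            ⨆ μ : Fin (d + 1), l2OfY hh (𝔏.Gp (fun _ _ => 1) (cdsS x.toKIdx (fun _ _ => 1) μ (liftY f (E : 𝔸)))),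
            ⨆ μ : Fin (d + 1), ⨆ ν : Fin (d + 1),
              l2OfY hh (cdS x.toKIdx (fun _ _ => 1) μ (𝔏.Gp (fun _ _ => 1) (cdsS x.toKIdx (fun _ _ => 1) ν (liftY f (E : 𝔸))))),
            ⨆ μ : Fin (d + 1), ⨆ ν : Fin (d + 1),
              l2OfY hh (cdS x.toKIdx (fun _ _ => 1) μ (cdS x.toKIdx (fun _ _ => 1) ν (𝔏.Gp (fun _ _ => 1) (liftY f (E : 𝔸))))),
            ⨆ μ : Fin (d + 1), ⨆ ν : Fin (d + 1),
              l2OfY hh (𝔏.Gp (fun _ _ => 1) (cdsS x.toKIdx (fun _ _ => 1) μ (cdsS x.toKIdx (fun _ _ => 1) ν (liftY f (E : 𝔸)))))] :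
          Fin 6 → ℝ) n) := rfl

/-- ★ member 0 at a member of Stage 3′(Y): `(ops x).Gp.l2 0 1 (.inl f) (.inl h) ≤ R` once `η²‖h·G′f‖ ≤ R` (`R ≥ 0`; `η = etaS = |c_f|⁻¹`).
[cite: Balaban1985BackgroundPropagators, (3.46) p.398 + Cor. 3.5 p.407] -/
theorem Gp_l2_one_inl_inl_le0 (f hh : SiteY x.toKIdx → ℝ) {R : ℝ} (hR : 0 ≤ R)
    (h : |x.cf|⁻¹ ^ 2 * l2Of hh ((toKT x.toKIdx).G *ᵥ f) ≤ R) :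
    (operatorLayerYOfLetters 𝔸 G x 𝔏 𝔈).Gp.l2 0 (bg9Y 𝔸 G x).one (Sum.inl f) (Sum.inl hh) ≤ R := by
  have hv : ((![2, 1, 1, 0, 0, 0] : Fin 6 → ℕ) 0) = 2 := rfl
  rw [Gp_l2_one_inl_inl, etaS_toKIdx, hv]
  exact mul_iSup_le (pow_nonneg (inv_nonneg.2 (abs_nonneg _)) 2) hR fun E =>
    (mul_le_mul_of_nonneg_left (l2S0_one_le x.toKIdx 𝔏.Gp 𝔏.Gp_one hh f E) (pow_nonneg (inv_nonneg.2 (abs_nonneg _)) 2)).trans h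

/-- ★ member 1: `(ops x).Gp.l2 1 1 (.inl f) (.inl h) ≤ R` once `η‖h·∂_μG′f‖ ≤ R` for every `μ`. [cite: Balaban1985BackgroundPropagators, (3.46) p.398 + Cor. 3.5 p.407] -/
theorem Gp_l2_one_inl_inl_le1 (f hh : SiteY x.toKIdx → ℝ) {R : ℝ} (hR : 0 ≤ R)
    (h : ∀ μ : Fin (d + 1), |x.cf|⁻¹ * l2Of hh ((dT (toKT x.toKIdx).NB μ * (toKT x.toKIdx).G) *ᵥ f) ≤ R) :
    (operatorLayerYOfLetters 𝔸 G x 𝔏 𝔈).Gp.l2 1 (bg9Y 𝔸 G x).one (Sum.inl f) (Sum.inl hh) ≤ R := by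
  have hv : ((![2, 1, 1, 0, 0, 0] : Fin 6 → ℕ) 1) = 1 := rfl
  rw [Gp_l2_one_inl_inl, etaS_toKIdx, hv, pow_one]
  refine mul_iSup_le (inv_nonneg.2 (abs_nonneg _)) hR fun E => ?_
  exact mul_iSup_le (inv_nonneg.2 (abs_nonneg _)) hR fun μ =>
    (mul_le_mul_of_nonneg_left (l2S1_one_le x.toKIdx 𝔏.Gp 𝔏.Gp_one hh f E μ) (inv_nonneg.2 (abs_nonneg _))).trans (h μ)

/-- ★ member 2: `(ops x).Gp.l2 2 1 (.inl f) (.inl h) ≤ R` once `η‖h·G′∂_μᵀf‖ ≤ R` for every `μ`. [cite: Balaban1985BackgroundPropagators, (3.46) p.398 + Cor. 3.5 p.407] -/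
theorem Gp_l2_one_inl_inl_le2 (f hh : SiteY x.toKIdx → ℝ) {R : ℝ} (hR : 0 ≤ R)
    (h : ∀ μ : Fin (d + 1), |x.cf|⁻¹ * l2Of hh (((toKT x.toKIdx).G * (dT (toKT x.toKIdx).NB μ)ᵀ) *ᵥ f) ≤ R) :
    (operatorLayerYOfLetters 𝔸 G x 𝔏 𝔈).Gp.l2 2 (bg9Y 𝔸 G x).one (Sum.inl f) (Sum.inl hh) ≤ R := by
  have hv : ((![2, 1, 1, 0, 0, 0] : Fin 6 → ℕ) 2) = 1 := rfl
  rw [Gp_l2_one_inl_inl, etaS_toKIdx, hv, pow_one]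
  refine mul_iSup_le (inv_nonneg.2 (abs_nonneg _)) hR fun E => ?_
  exact mul_iSup_le (inv_nonneg.2 (abs_nonneg _)) hR fun μ =>
    (mul_le_mul_of_nonneg_left (l2S2_one_le x.toKIdx 𝔏.Gp 𝔏.Gp_one hh f E μ) (inv_nonneg.2 (abs_nonneg _))).trans (h μ)

/-- `pref6 t 0 = t²`. [cite: Balaban1985BackgroundPropagators, (3.46) p.398 (the prefactors), bookkeeping] -/
theorem pref6_zero (t : ℝ) : B9.pref6 t 0 = t ^ 2 := rfl
/-- `pref6 t 1 = t`. [cite: Balaban1985BackgroundPropagators, (3.46) p.398 (the prefactors), bookkeeping] -/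
theorem pref6_one (t : ℝ) : B9.pref6 t 1 = t := rfl
/-- `pref6 t 2 = t`. [cite: Balaban1985BackgroundPropagators, (3.46) p.398 (the prefactors), bookkeeping] -/
theorem pref6_two (t : ℝ) : B9.pref6 t 2 = t := rfl

/-- dictionary at a member: `(geo9Y x).len c = L^{lvl c}·η = (L^{j(βc)}·|c_f|⁻¹)` (`beta_level`). [cite: Balaban1984PropagatorsII, (2.1) p.224, dictionary] -/
theorem len_geo9Y_eq (c : (geo9Y x).Site) :
    (geo9Y x).len c = ((ℓ : ℝ) + 1) ^ (β x.hN x.D x.hk c).1.1 * |x.cf|⁻¹ := by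
  rw [beta_level x.hN x.D x.hk (le_trans one_le_two x.hk2) c]
  show (((ℓ + 1 : ℕ) : ℝ)) ^ _ * |x.cf|⁻¹ = _
  push_cast
  rfl

end Member

/-! ## §4 The three member-leaves at the layer of letters; row 11 from exactly the unprinted entries -/

section Layer

variable {G : Subgroup 𝔸ˣ} (𝔏 : ∀ x : MemberY d ℓ hd hL b₀ b₁ Mstar, CovLettersY 𝔸 x)
  (𝔈 : ∀ x : MemberY d ℓ hd hL b₀ b₁ Mstar, ExpLettersY 𝔸 G x)

/-- the right-hand side of the (3.46) leaf is `≥ 0` at the carriers of record (sign facts of dag-n03-b's `modelSignsOn_geo9K`).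
[cite: Balaban1985BackgroundPropagators, (3.46) p.398 + (3.39)–(3.41) p.397, bookkeeping] -/
theorem l2rhs_nonneg (x : MemberY d ℓ hd hL b₀ b₁ Mstar) {B₀ δ₀ : ℝ} (hB : 0 ≤ B₀) (n : Fin 6) (lam : (geo9Y x).Loc)
    (h : (geo9Y x).Cut) (y y' : (geo9Y x).Site) :
    0 ≤ B₀ * B9.pref6 ((geo9Y x).len y) n * (geo9Y x).cutSup h * Real.exp (-(δ₀ * (geo9Y x).dist y y')) * (geo9Y x).l2Norm lam := by
  have S := B9GeoNormsKLevelModelSignsV1.modelSignsOn_geo9K x.toKIdx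
  exact mul_nonneg (mul_nonneg (mul_nonneg (mul_nonneg hB (pref6_nonneg (S.len_nonneg y) n)) (S.cutSup_nonneg h))
    (Real.exp_nonneg _)) (S.l2Norm_nonneg lam)

/-- ★★ **THE (3.46) MEMBER-LEAF `‖hG′λ‖` OF ROW 11 HOLDS AT NODE 00's LAYER OF LETTERS**, every `𝔏 𝔈`: one threshold, one `B₀`, one `δ₀` with
`(ops x).Gp.l2 0 1 λ h ≤ B₀(Lʲη)²|h|e^{−δ₀d(y,y′)}‖λ‖` for site arguments `λ` supported in `Δ(y′)` and cut-offs `h` in `Δ(y)` (one-block readings of the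
record). [cite: Balaban1985BackgroundPropagators, Thm 3.1 (3.46) p.398 + Cor. 3.5 p.407; Balaban1984PropagatorsII, Prop. 2.2 (2.67), (2.60) p.234] -/
theorem atOneL2nOn_Gp_letters_0 :
    AtOneL2nOn geo9Y (bg9Y 𝔸 G) (fun x => (operatorLayerYOfLetters 𝔸 G x (𝔏 x) (𝔈 x)).Gp) (fun _ lam => ¬ (lam.isRight = true)) 0 := by
  obtain ⟨M₁, C, δ₀, hM₁, hC, hδ₀, H⟩ := ineq346_Gp_kIdx_members (d := d) (ℓ := ℓ) (hd := hd) (hL := hL) (b₀ := b₀) (b₁ := b₁)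
  refine ⟨M₁, C, δ₀, hM₁, hC, hδ₀, fun x hx lam h y y' hP hcut hsupp => ?_⟩
  cases lam with
  | inr J => exact absurd rfl hP
  | inl f =>
    cases h with
    | inr z =>
        rw [Gp_l2_inl_inr]
        exact l2rhs_nonneg x hC.le 0 _ _ y y'
    | inl hh =>
        have hk := (H x.toKIdx hx (β x.hN x.D x.hk y) (β x.hN x.D x.hk y') hh f hcut hsupp).1
        refine Gp_l2_one_inl_inl_le0 x (𝔏 x) (𝔈 x) f hh (l2rhs_nonneg x hC.le 0 _ _ y y') (hk.trans (le_of_eq ?_))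
        rw [len_geo9Y_eq, pref6_zero]
        rfl

/-- ★★ **THE (3.46) MEMBER-LEAF `‖h∇_UG′λ‖` OF ROW 11 HOLDS AT THE LAYER OF LETTERS**, every `𝔏 𝔈`.
[cite: Balaban1985BackgroundPropagators, Thm 3.1 (3.46) p.398 + Cor. 3.5 p.407; Balaban1984PropagatorsII, Prop. 2.2 (2.67), (2.60) p.234] -/
theorem atOneL2nOn_Gp_letters_1 :
    AtOneL2nOn geo9Y (bg9Y 𝔸 G) (fun x => (operatorLayerYOfLetters 𝔸 G x (𝔏 x) (𝔈 x)).Gp) (fun _ lam => ¬ (lam.isRight = true)) 1 := by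
  obtain ⟨M₁, C, δ₀, hM₁, hC, hδ₀, H⟩ := ineq346_Gp_kIdx_members (d := d) (ℓ := ℓ) (hd := hd) (hL := hL) (b₀ := b₀) (b₁ := b₁)
  refine ⟨M₁, C, δ₀, hM₁, hC, hδ₀, fun x hx lam h y y' hP hcut hsupp => ?_⟩
  cases lam with
  | inr J => exact absurd rfl hP
  | inl f =>
    cases h with
    | inr z =>
        rw [Gp_l2_inl_inr]
        exact l2rhs_nonneg x hC.le 1 _ _ y y'
    | inl hh =>
        have hk := (H x.toKIdx hx (β x.hN x.D x.hk y) (β x.hN x.D x.hk y') hh f hcut hsupp).2.1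
        refine Gp_l2_one_inl_inl_le1 x (𝔏 x) (𝔈 x) f hh (l2rhs_nonneg x hC.le 1 _ _ y y') fun μ => (hk μ).trans (le_of_eq ?_)
        rw [len_geo9Y_eq, pref6_one]
        rfl

/-- ★★ **THE (3.46) MEMBER-LEAF `‖hG′∇*_Uλ‖` OF ROW 11 HOLDS AT THE LAYER OF LETTERS**, every `𝔏 𝔈`.
[cite: Balaban1985BackgroundPropagators, Thm 3.1 (3.46) p.398 + Cor. 3.5 p.407; Balaban1984PropagatorsII, Prop. 2.2 (2.67), (2.60) p.234] -/
theorem atOneL2nOn_Gp_letters_2 :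
    AtOneL2nOn geo9Y (bg9Y 𝔸 G) (fun x => (operatorLayerYOfLetters 𝔸 G x (𝔏 x) (𝔈 x)).Gp) (fun _ lam => ¬ (lam.isRight = true)) 2 := by
  obtain ⟨M₁, C, δ₀, hM₁, hC, hδ₀, H⟩ := ineq346_Gp_kIdx_members (d := d) (ℓ := ℓ) (hd := hd) (hL := hL) (b₀ := b₀) (b₁ := b₁)
  refine ⟨M₁, C, δ₀, hM₁, hC, hδ₀, fun x hx lam h y y' hP hcut hsupp => ?_⟩
  cases lam with
  | inr J => exact absurd rfl hP
  | inl f =>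
    cases h with
    | inr z =>
        rw [Gp_l2_inl_inr]
        exact l2rhs_nonneg x hC.le 2 _ _ y y'
    | inl hh =>
        have hk := (H x.toKIdx hx (β x.hN x.D x.hk y) (β x.hN x.D x.hk y') hh f hcut hsupp).2.2
        refine Gp_l2_one_inl_inl_le2 x (𝔏 x) (𝔈 x) f hh (l2rhs_nonneg x hC.le 2 _ _ y y') fun μ => (hk μ).trans (le_of_eq ?_)
        rw [len_geo9Y_eq, pref6_two]
        rfl

/-- ★★ **ROW `hGp` AT THE LAYER OF LETTERS FROM EXACTLY THE ENTRIES [4] DOES NOT PRINT AT U = 1** — the (3.46) member-leaves n = 3, 4, 5 (`∇G′∇*`,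
`∇∇G′`, `G′∇*∇*`), (3.43) with Δ̃-cut-offs, (3.44), (3.45) for G′(1) on site arguments (G-B9-03a ∕ G-B9-20); the (3.46) members 0, 1, 2 (this file)
and the (3.47) leaf (`B9Ineq347GpAtLetters`) are PROVED; signs by `modelSignsOn_geo9K`.
[cite: Balaban1985BackgroundPropagators, Cor. 3.5 p.407 + Thm 3.1 (3.43)–(3.47) p.398; Balaban1984PropagatorsII, Prop. 2.2 (2.67) p.234] -/
theorem residualGpAtOne_letters_of_leaves
    (hL3 : AtOneL2nOn geo9Y (bg9Y 𝔸 G) (fun x => (operatorLayerYOfLetters 𝔸 G x (𝔏 x) (𝔈 x)).Gp) (fun _ lam => ¬ (lam.isRight = true)) 3)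
    (hL4 : AtOneL2nOn geo9Y (bg9Y 𝔸 G) (fun x => (operatorLayerYOfLetters 𝔸 G x (𝔏 x) (𝔈 x)).Gp) (fun _ lam => ¬ (lam.isRight = true)) 4)
    (hL5 : AtOneL2nOn geo9Y (bg9Y 𝔸 G) (fun x => (operatorLayerYOfLetters 𝔸 G x (𝔏 x) (𝔈 x)).Gp) (fun _ lam => ¬ (lam.isRight = true)) 5)
    (hH1 : AtOneH1On geo9Y (bg9Y 𝔸 G) (fun x => (operatorLayerYOfLetters 𝔸 G x (𝔏 x) (𝔈 x)).Gp) (fun _ lam => ¬ (lam.isRight = true)))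
    (hE4 : AtOneE4On geo9Y (bg9Y 𝔸 G) (fun x => (operatorLayerYOfLetters 𝔸 G x (𝔏 x) (𝔈 x)).Gp) (fun _ lam => ¬ (lam.isRight = true)))
    (hH2 : AtOneH2On geo9Y (bg9Y 𝔸 G) (fun x => (operatorLayerYOfLetters 𝔸 G x (𝔏 x) (𝔈 x)).Gp) (fun _ lam => ¬ (lam.isRight = true))) :
    ResidualGpAtOne geo9Y (bg9Y 𝔸 G) (fun x => (operatorLayerYOfLetters 𝔸 G x (𝔏 x) (𝔈 x)).Gp) := by
  refine residualGpAtOne_letters_of_blocksOn 𝔏 𝔈 ?_ (atOneGlobOn_Gp_letters 𝔏 𝔈) hH1 hE4 hH2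
  refine atOneL2On_of_members (fun x => B9GeoNormsKLevelModelSignsV1.modelSignsOn_geo9K x.toKIdx) fun n => ?_
  fin_cases n
  · exact atOneL2nOn_Gp_letters_0 𝔏 𝔈
  · exact atOneL2nOn_Gp_letters_1 𝔏 𝔈
  · exact atOneL2nOn_Gp_letters_2 𝔏 𝔈
  · exact hL3
  · exact hL4
  · exact hL5

end Layer

/-! ## §5 At the record: `ops := opsYOfLetters N θ M⋆ 𝔏 𝔈` -/

section Record

open scoped Matrix.Norms.L2Operator

variable (N : ℕ) (θ : Stage3Params) (Mstar' : ℕ) (𝔏 : LettersY N θ Mstar') (𝔈 : ExpsY N θ Mstar')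

/-- ★★ the (3.46) member-leaf `‖hG′λ‖` at the record's layer of letters. [cite: Balaban1985BackgroundPropagators, Thm 3.1 (3.46) p.398 + Cor. 3.5 p.407] -/
theorem atOneL2nOn_Gp_opsYOfLetters_0 :
    AtOneL2nOn geo9Y (bg9Y (Matrix (Fin N) (Fin N) ℂ) (specialUnitaryUnits (Fin N))) (fun x => (opsYOfLetters N θ Mstar' 𝔏 𝔈 x).Gp)
      (fun _ lam => ¬ (lam.isRight = true)) 0 :=
  atOneL2nOn_Gp_letters_0 𝔏 𝔈

/-- ★★ the (3.46) member-leaf `‖h∇_UG′λ‖` at the record's layer of letters. [cite: Balaban1985BackgroundPropagators, Thm 3.1 (3.46) p.398 + Cor. 3.5 p.407] -/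
theorem atOneL2nOn_Gp_opsYOfLetters_1 :
    AtOneL2nOn geo9Y (bg9Y (Matrix (Fin N) (Fin N) ℂ) (specialUnitaryUnits (Fin N))) (fun x => (opsYOfLetters N θ Mstar' 𝔏 𝔈 x).Gp)
      (fun _ lam => ¬ (lam.isRight = true)) 1 :=
  atOneL2nOn_Gp_letters_1 𝔏 𝔈

/-- ★★ the (3.46) member-leaf `‖hG′∇*_Uλ‖` at the record's layer of letters. [cite: Balaban1985BackgroundPropagators, Thm 3.1 (3.46) p.398 + Cor. 3.5 p.407] -/
theorem atOneL2nOn_Gp_opsYOfLetters_2 :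
    AtOneL2nOn geo9Y (bg9Y (Matrix (Fin N) (Fin N) ℂ) (specialUnitaryUnits (Fin N))) (fun x => (opsYOfLetters N θ Mstar' 𝔏 𝔈 x).Gp)
      (fun _ lam => ¬ (lam.isRight = true)) 2 :=
  atOneL2nOn_Gp_letters_2 𝔏 𝔈

/-- ★★ **THE KNIT BINDER `hGp` AT NODE 00's OPERATOR LAYER OF LETTERS FROM EXACTLY THE ENTRIES [4] DOES NOT PRINT AT U = 1** — conclusion LITERALLY the
binder `hGp` of `Summit.…b9_main_of_up_view₁₁B10YZW_of_obligations` at `ops := opsYOfLetters N θ M⋆ 𝔏 𝔈`; hypotheses = the printed-shape member-leaves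
(3.46)₃,₄,₅ and the leaves (3.43)Δ̃, (3.44), (3.45) of G′(1) on site arguments (G-B9-03a ∕ G-B9-20); (3.46)₀,₁,₂ and (3.47) are PROVED.
[cite: Balaban1985BackgroundPropagators, Cor. 3.5 p.407 + Thm 3.1 (3.43)–(3.47) p.398; Balaban1984PropagatorsII, Prop. 2.2 (2.67), Lemma 2.1 p.234] -/
theorem hGp_opsYOfLetters_of_leaves
    (hL3 : AtOneL2nOn geo9Y (bg9Y (Matrix (Fin N) (Fin N) ℂ) (specialUnitaryUnits (Fin N))) (fun x => (opsYOfLetters N θ Mstar' 𝔏 𝔈 x).Gp)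
      (fun _ lam => ¬ (lam.isRight = true)) 3)
    (hL4 : AtOneL2nOn geo9Y (bg9Y (Matrix (Fin N) (Fin N) ℂ) (specialUnitaryUnits (Fin N))) (fun x => (opsYOfLetters N θ Mstar' 𝔏 𝔈 x).Gp)
      (fun _ lam => ¬ (lam.isRight = true)) 4)
    (hL5 : AtOneL2nOn geo9Y (bg9Y (Matrix (Fin N) (Fin N) ℂ) (specialUnitaryUnits (Fin N))) (fun x => (opsYOfLetters N θ Mstar' 𝔏 𝔈 x).Gp)
      (fun _ lam => ¬ (lam.isRight = true)) 5)
    (hH1 : AtOneH1On geo9Y (bg9Y (Matrix (Fin N) (Fin N) ℂ) (specialUnitaryUnits (Fin N))) (fun x => (opsYOfLetters N θ Mstar' 𝔏 𝔈 x).Gp)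
      (fun _ lam => ¬ (lam.isRight = true)))
    (hE4 : AtOneE4On geo9Y (bg9Y (Matrix (Fin N) (Fin N) ℂ) (specialUnitaryUnits (Fin N))) (fun x => (opsYOfLetters N θ Mstar' 𝔏 𝔈 x).Gp)
      (fun _ lam => ¬ (lam.isRight = true)))
    (hH2 : AtOneH2On geo9Y (bg9Y (Matrix (Fin N) (Fin N) ℂ) (specialUnitaryUnits (Fin N))) (fun x => (opsYOfLetters N θ Mstar' 𝔏 𝔈 x).Gp)
      (fun _ lam => ¬ (lam.isRight = true))) :
    B9FromB6.ResidualGpAtOne geo9Y (bg9Y (Matrix (Fin N) (Fin N) ℂ) (specialUnitaryUnits (Fin N))) (fun x => (opsYOfLetters N θ Mstar' 𝔏 𝔈 x).Gp) :=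
  residualGpAtOne_letters_of_leaves 𝔏 𝔈 hL3 hL4 hL5 hH1 hE4 hH2

end Record

end Literature.MathematicalPhysics.QuantumFieldTheory.Balaban1983to89.B9Ineq346GpAtLetters

end
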